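import Mathlib
import HarnessLib
import HarnessLib.Audit
import Summits.ValiantsHypothesis.ValiantsHypothesis.Theorems.LacunarySymmetroidMatrixDescartesToyALawDefs

/-!
# ValiantsHypothesis / LacunarySymmetroid — crux `MatrixDescartes` (stmt-ValiantsHypothesis-18050, V1), LINE (A) «product_plus_one»:
# binomial-limit TOY THEOREM, module 4 — from `V(φ) ≤ R` to a one-signed polynomial multiplier

Bridge between the sign-change count (modules 1/2) and Laguerre's transfer (Pólya–Szegő II, V.80) in pen val-idea-25 g8
NOTE §54.13: if `φ`, continuous on an order-connected `I`, has at most `R` sign changes on `I`, then there are `V ≤ R` zeros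
`c 0, …, c (V−1) ∈ I` of `φ` with `(∏_{j<V} (c j − θ))·φ(θ)` weakly one-signed on `I` (`exists_multiplier_of_signChangesLE`).
Construction: a maximal alternating chain `x 0 < ⋯ < x V`; `c j` = the first sign change of `φ` after `x j`
(`inf {u ∈ [x j, x (j+1)] : φ(x j)φ(u) < 0}`); a point with the wrong sign would extend the chain.
HONEST FRAMING: generic helper; no LINE (A) stub touched; `MatrixDescartes` OPEN; `VP ≠ VNP` NOT proved, nothing here bears on it.
-/

set_option linter.dupNamespace false

namespace Summit.ValiantsHypothesis.ValiantsHypothesis.Theorems.LacunarySymmetroidMatrixDescartes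

namespace ToyALaw

open Finset

variable {φ : ℝ → ℝ} {S : Set ℝ} {n : ℕ} {x : ℕ → ℝ}

/-! ## Alternating chains (`IsAltChain`, defined in `…ToyALawDefs`) -/

/-- `SignChangesLE φ S R` forbids alternating chains with `R + 1` (or more) sign changes. -/
theorem SignChangesLE.not_isAltChain {R : ℕ} (h : SignChangesLE φ S R) (hn : R + 1 ≤ n) :
    ¬ IsAltChain φ S n x := by
  rintro ⟨hS, hlt, hsign⟩
  obtain ⟨i, hi, h0⟩ := h x (fun i hi => hS i (by omega)) (fun i hi => hlt i (by omega))
  exact absurd (hsign i (by omega)) (not_lt.2 h0)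

/-- Points of an alternating chain increase. -/
theorem IsAltChain.lt (h : IsAltChain φ S n x) {a b : ℕ} (hab : a < b) (hb : b ≤ n) : x a < x b := by
  obtain ⟨d, rfl⟩ : ∃ d, b = a + d + 1 := ⟨b - a - 1, by omega⟩
  induction d with
  | zero => simpa using h.2.1 a (by omega)
  | succ d ih =>
    have h1 := ih (by omega) (by omega)
    have h2 := h.2.1 (a + d + 1) (by omega)
    calc x a < x (a + d + 1) := h1
      _ < x (a + d + 1 + 1) := h2
      _ = x (a + (d + 1) + 1) := by ring_nf

/-- Points of an alternating chain increase (weak form). -/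
theorem IsAltChain.le (h : IsAltChain φ S n x) {a b : ℕ} (hab : a ≤ b) (hb : b ≤ n) : x a ≤ x b := by
  rcases eq_or_lt_of_le hab with rfl | hlt
  · exact le_rfl
  · exact (h.lt hlt hb).le

/-- Along an alternating chain whose first value is nonzero, all values are nonzero. -/
theorem IsAltChain.ne_zero (h : IsAltChain φ S n x) (h0 : φ (x 0) ≠ 0) : ∀ i ≤ n, φ (x i) ≠ 0 := by
  intro i hi
  rcases Nat.eq_zero_or_pos i with rfl | hpos
  · exact h0
  · intro hz
    have := h.2.2 (i - 1) (by omega)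
    rw [show i - 1 + 1 = i by omega, hz, mul_zero] at this
    exact lt_irrefl _ this

/-- Prepending a point with the opposite sign in front of an alternating chain. -/
theorem isAltChain_prepend (h : IsAltChain φ S n x) {θ : ℝ} (hθ : θ ∈ S) (hlt : θ < x 0)
    (hs : φ θ * φ (x 0) < 0) :
    IsAltChain φ S (n + 1) (fun i => if i = 0 then θ else x (i - 1)) := by
  refine ⟨fun i hi => ?_, fun i hi => ?_, fun i hi => ?_⟩
  · rcases Nat.eq_zero_or_pos i with rfl | hpos
    · simpa using hθ
    · simp only [if_neg (by omega : i ≠ 0)]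
      exact h.1 _ (by omega)
  · rcases Nat.eq_zero_or_pos i with rfl | hpos
    · simpa using hlt
    · simp only [if_neg (by omega : i ≠ 0), if_neg (by omega : i + 1 ≠ 0), show i + 1 - 1 = (i - 1) + 1 by omega]
      exact h.2.1 _ (by omega)
  · rcases Nat.eq_zero_or_pos i with rfl | hpos
    · simpa using hs
    · simp only [if_neg (by omega : i ≠ 0), if_neg (by omega : i + 1 ≠ 0), show i + 1 - 1 = (i - 1) + 1 by omega]
      exact h.2.2 _ (by omega)

/-- Appending a point with the opposite sign after an alternating chain. -/
theorem isAltChain_append (h : IsAltChain φ S n x) {θ : ℝ} (hθ : θ ∈ S) (hlt : x n < θ)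
    (hs : φ (x n) * φ θ < 0) :
    IsAltChain φ S (n + 1) (fun i => if i ≤ n then x i else θ) := by
  refine ⟨fun i hi => ?_, fun i hi => ?_, fun i hi => ?_⟩
  · by_cases hin : i ≤ n
    · simp only [if_pos hin]; exact h.1 i hin
    · simp only [if_neg hin]; exact hθ
  · by_cases hin : i + 1 ≤ n
    · simp only [if_pos hin, if_pos (by omega : i ≤ n)]; exact h.2.1 i (by omega)
    · have : i = n := by omega
      subst this
      simp only [if_pos le_rfl, if_neg (by omega : ¬ i + 1 ≤ i)]; exact hlt
  · by_cases hin : i + 1 ≤ n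
    · simp only [if_pos hin, if_pos (by omega : i ≤ n)]; exact h.2.2 i (by omega)
    · have : i = n := by omega
      subst this
      simp only [if_pos le_rfl, if_neg (by omega : ¬ i + 1 ≤ i)]; exact hs

/-- Inserting two consecutive points `w < θ` between `x (k−1)` and `x k` of an alternating chain, with the right signs,
gives an alternating chain with two more sign changes. -/
theorem isAltChain_insert2 (h : IsAltChain φ S n x) {k : ℕ} (hk : 0 < k) (hkn : k ≤ n) {w θ : ℝ}
    (hw : w ∈ S) (hθ : θ ∈ S) (h1 : x (k - 1) < w) (h2 : w < θ) (h3 : θ < x k)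
    (s1 : φ (x (k - 1)) * φ w < 0) (s2 : φ w * φ θ < 0) (s3 : φ θ * φ (x k) < 0) :
    IsAltChain φ S (n + 2)
      (fun i => if i < k then x i else if i = k then w else if i = k + 1 then θ else x (i - 2)) := by
  set y : ℕ → ℝ := fun i => if i < k then x i else if i = k then w else if i = k + 1 then θ else x (i - 2) with hy
  have y_lt : ∀ i, i < k → y i = x i := fun i hi => by simp only [hy, if_pos hi]
  have y_k : y k = w := by simp only [hy, lt_irrefl, if_false, if_true]
  have y_k1 : y (k + 1) = θ := by
    simp only [hy, if_neg (by omega : ¬ k + 1 < k), if_neg (by omega : k + 1 ≠ k), if_true]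
  have y_ge : ∀ i, k + 2 ≤ i → y i = x (i - 2) := fun i hi => by
    simp only [hy, if_neg (by omega : ¬ i < k), if_neg (by omega : i ≠ k), if_neg (by omega : i ≠ k + 1)]
  refine ⟨fun i hi => ?_, fun i hi => ?_, fun i hi => ?_⟩
  · -- membership
    rcases (by omega : i < k ∨ i = k ∨ i = k + 1 ∨ k + 2 ≤ i) with hi' | rfl | rfl | hi'
    · rw [y_lt i hi']; exact h.1 i (by omega)
    · rw [y_k]; exact hw
    · rw [y_k1]; exact hθ
    · rw [y_ge i hi']; exact h.1 _ (by omega)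
  · -- order
    rcases (by omega : i + 1 < k ∨ i + 1 = k ∨ i = k ∨ i = k + 1 ∨ k + 2 ≤ i) with hi' | hi' | rfl | rfl | hi'
    · rw [y_lt i (by omega), y_lt (i + 1) hi']; exact h.2.1 i (by omega)
    · have : i = k - 1 := by omega
      subst this
      rw [y_lt (k - 1) (by omega), hi', y_k]; exact h1
    · rw [y_k, y_k1]; exact h2
    · rw [y_k1, y_ge (k + 1 + 1) (by omega), show k + 1 + 1 - 2 = k by omega]; exact h3
    · rw [y_ge i hi', y_ge (i + 1) (by omega), show i + 1 - 2 = (i - 2) + 1 by omega]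
      exact h.2.1 _ (by omega)
  · -- signs
    rcases (by omega : i + 1 < k ∨ i + 1 = k ∨ i = k ∨ i = k + 1 ∨ k + 2 ≤ i) with hi' | hi' | rfl | rfl | hi'
    · rw [y_lt i (by omega), y_lt (i + 1) hi']; exact h.2.2 i (by omega)
    · have : i = k - 1 := by omega
      subst this
      rw [y_lt (k - 1) (by omega), hi', y_k]; exact s1
    · rw [y_k, y_k1]; exact s2
    · rw [y_k1, y_ge (k + 1 + 1) (by omega), show k + 1 + 1 - 2 = k by omega]; exact s3
    · rw [y_ge i hi', y_ge (i + 1) (by omega), show i + 1 - 2 = (i - 2) + 1 by omega]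
      exact h.2.2 _ (by omega)

/-! ## The first sign change after a point -/

/-- Two real numbers close in the sense `|q − p| < |p|` have the same strict sign. -/
theorem mul_pos_of_abs_sub_lt {p q : ℝ} (h : |q - p| < |p|) : 0 < p * q := by
  rcases lt_trichotomy p 0 with hp | rfl | hp
  · rw [abs_of_neg hp, abs_sub_lt_iff] at h
    exact mul_pos_of_neg_of_neg hp (by linarith)
  · rw [sub_zero, abs_zero] at h
    exact absurd h (not_lt.2 (abs_nonneg q))
  · rw [abs_of_pos hp, abs_sub_lt_iff] at h
    exact mul_pos hp (by linarith)

/-- **First sign change.** If `φ` is continuous on an order-connected set `I` and `a < b` are points of `I` with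
`φ a · φ b < 0`, then `c = inf {u ∈ [a,b] : φ(a)φ(u) < 0}` satisfies: `a < c < b`, `φ c = 0`, `φ(a)φ(u) ≥ 0` on `[a, c]`,
and there are points `w > c` arbitrarily close to `c` (and `≤ b`) with `φ(a)φ(w) < 0`. -/
theorem exists_first_signChange {I : Set ℝ} (hI : I.OrdConnected) (hφ : ContinuousOn φ I) {a b : ℝ}
    (ha : a ∈ I) (hb : b ∈ I) (hab : a < b) (hs : φ a * φ b < 0) :
    ∃ c, a < c ∧ c < b ∧ φ c = 0 ∧ (∀ u, a ≤ u → u ≤ c → 0 ≤ φ a * φ u) ∧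
      (∀ ε > 0, ∃ w, c < w ∧ w < c + ε ∧ w ≤ b ∧ φ a * φ w < 0) := by
  set T : Set ℝ := {u | a ≤ u ∧ u ≤ b ∧ φ a * φ u < 0} with hT
  have hbT : b ∈ T := ⟨hab.le, le_rfl, hs⟩
  have hne : T.Nonempty := ⟨b, hbT⟩
  have hbdd : BddBelow T := ⟨a, fun u hu => hu.1⟩
  set c := sInf T with hc
  have hac : a ≤ c := le_csInf hne fun u hu => hu.1
  have hcb : c ≤ b := csInf_le hbdd hbT
  have hcI : c ∈ I := hI.out ha hb ⟨hac, hcb⟩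
  have hφa : φ a ≠ 0 := by rintro h0; simp [h0] at hs
  have happrox : ∀ ε > 0, ∃ w ∈ T, w < c + ε := fun ε hε =>
    exists_lt_of_csInf_lt hne (lt_add_of_pos_right c hε)
  have hcont := Metric.continuousWithinAt_iff.1 (hφ c hcI)
  -- φ c = 0
  have hφc : φ c = 0 := by
    by_contra hne0
    obtain ⟨δ, hδ, hδ'⟩ := hcont |φ c| (abs_pos.2 hne0)
    rcases lt_or_gt_of_ne (show φ a * φ c ≠ 0 from mul_ne_zero hφa hne0) with hneg | hpos
    · -- φ a φ c < 0: points slightly left of c are in T, contradiction with c = inf T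
      have hca : a < c := lt_of_le_of_ne hac (by
        intro h; rw [← h] at hneg; exact absurd hneg (not_lt.2 (mul_self_nonneg _)))
      set u := max (c - δ / 2) ((a + c) / 2) with hu
      have hu1 : u < c := max_lt (by linarith) (by linarith)
      have hu2 : a < u := lt_of_lt_of_le (by linarith) (le_max_right _ _)
      have huI : u ∈ I := hI.out ha hcI ⟨hu2.le, hu1.le⟩
      have hdist : dist u c < δ := by
        rw [Real.dist_eq, abs_sub_comm, abs_of_pos (by linarith)]
        linarith [le_max_left (c - δ / 2) ((a + c) / 2)]
      have hclose := hδ' huI hdist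
      rw [Real.dist_eq] at hclose
      have hsame : 0 < φ c * φ u := mul_pos_of_abs_sub_lt hclose
      have huT : u ∈ T := by
        refine ⟨hu2.le, hu1.le.trans hcb, ?_⟩
        have e : (φ a * φ u) * (φ c) ^ 2 = (φ a * φ c) * (φ c * φ u) := by ring
        nlinarith [mul_neg_of_neg_of_pos hneg hsame, sq_nonneg (φ c), mul_self_pos.2 hne0]
      exact absurd (csInf_le hbdd huT) (not_le.2 hu1)
    · -- φ a φ c > 0: points of T slightly right of c have the wrong sign
      obtain ⟨w, hwT, hwc⟩ := happrox δ hδ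
      have hcw : c ≤ w := csInf_le hbdd hwT
      have hwI : w ∈ I := hI.out ha hb ⟨hwT.1, hwT.2.1⟩
      have hdist : dist w c < δ := by
        rw [Real.dist_eq, abs_of_nonneg (by linarith)]; linarith
      have hclose := hδ' hwI hdist
      rw [Real.dist_eq] at hclose
      have hsame : 0 < φ c * φ w := mul_pos_of_abs_sub_lt hclose
      have e : (φ a * φ w) * (φ c) ^ 2 = (φ a * φ c) * (φ c * φ w) := by ring
      nlinarith [mul_pos hpos hsame, sq_nonneg (φ c), hwT.2.2]
  have hca : a < c := lt_of_le_of_ne hac (by rintro h; rw [← h] at hφc; exact hφa hφc)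
  have hcb' : c < b := lt_of_le_of_ne hcb (by rintro h; rw [h] at hφc; simp [hφc] at hs)
  refine ⟨c, hca, hcb', hφc, fun u hau huc => ?_, fun ε hε => ?_⟩
  · by_contra hlt
    push Not at hlt
    have huT : u ∈ T := ⟨hau, huc.trans hcb, hlt⟩
    have hcu : c ≤ u := csInf_le hbdd huT
    have : u = c := le_antisymm huc hcu
    rw [this, hφc, mul_zero] at hlt
    exact lt_irrefl _ hlt
  · obtain ⟨w, hwT, hwc⟩ := happrox ε hε
    have hcw : c ≤ w := csInf_le hbdd hwT
    have hne' : c ≠ w := by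
      rintro rfl; have := hwT.2.2; rw [hφc, mul_zero] at this; exact lt_irrefl _ this
    exact ⟨w, lt_of_le_of_ne hcw hne', hwc, hwT.2.1, hwT.2.2⟩

/-! ## The multiplier -/

/-- **From `V(φ) ≤ R` to a one-signed multiplier** (the sign-change partition used by Laguerre's proof of Pólya–Szegő V.80).
If `φ` is continuous on an order-connected set `I` and has at most `R` sign changes on `I`, there are `V ≤ R` zeros
`c 0, …, c (V−1) ∈ I` of `φ` such that `(∏_{j<V} (c j − θ))·φ(θ)` is `≥ 0` on all of `I` or `≤ 0` on all of `I`. -/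
theorem exists_multiplier_of_signChangesLE {I : Set ℝ} (hI : I.OrdConnected) (hφ : ContinuousOn φ I) {R : ℕ}
    (h : SignChangesLE φ I R) :
    ∃ V ≤ R, ∃ c : ℕ → ℝ, (∀ j < V, c j ∈ I ∧ φ (c j) = 0) ∧
      ((∀ θ ∈ I, 0 ≤ (∏ j ∈ range V, (c j - θ)) * φ θ) ∨
       (∀ θ ∈ I, (∏ j ∈ range V, (c j - θ)) * φ θ ≤ 0)) := by
  classical
  by_cases hz : ∀ θ ∈ I, φ θ = 0
  · exact ⟨0, Nat.zero_le _, fun _ => 0, fun j hj => absurd hj (Nat.not_lt_zero _),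
      Or.inl fun θ hθ => by simp [hz θ hθ]⟩
  push Not at hz
  obtain ⟨x₀, hx₀I, hx₀⟩ := hz
  -- a maximal alternating chain
  set P : ℕ → Prop := fun n => ∃ x : ℕ → ℝ, IsAltChain φ I n x ∧ φ (x 0) ≠ 0 with hP
  have hP0 : P 0 := ⟨fun _ => x₀, ⟨fun i _ => hx₀I, fun i hi => absurd hi (Nat.not_lt_zero _),
    fun i hi => absurd hi (Nat.not_lt_zero _)⟩, hx₀⟩
  set V := Nat.findGreatest P R with hV
  have hPV : P V := Nat.findGreatest_spec (Nat.zero_le R) hP0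
  have hVle : V ≤ R := Nat.findGreatest_le R
  have hmax : ∀ n, V < n → ¬ P n := by
    intro n hn
    by_cases hnR : n ≤ R
    · exact Nat.findGreatest_is_greatest hn hnR
    · rintro ⟨y, hy, -⟩
      exact h.not_isAltChain (by omega) hy
  obtain ⟨x, hx, hx0⟩ := hPV
  have hxne : ∀ i ≤ V, φ (x i) ≠ 0 := hx.ne_zero hx0
  -- first sign changes c j ∈ (x j, x (j+1))
  have hF : ∀ j < V, ∃ c, x j < c ∧ c < x (j + 1) ∧ φ c = 0 ∧ (∀ u, x j ≤ u → u ≤ c → 0 ≤ φ (x j) * φ u) ∧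
      (∀ ε > 0, ∃ w, c < w ∧ w < c + ε ∧ w ≤ x (j + 1) ∧ φ (x j) * φ w < 0) := fun j hj =>
    exists_first_signChange hI hφ (hx.1 j (by omega)) (hx.1 (j + 1) (by omega)) (hx.2.1 j hj) (hx.2.2 j hj)
  choose! c hc1 hc2 hc3 hc4 hc5 using hF
  have hcI : ∀ j < V, c j ∈ I := fun j hj =>
    hI.out (hx.1 j (by omega)) (hx.1 (j + 1) (by omega)) ⟨(hc1 j hj).le, (hc2 j hj).le⟩
  refine ⟨V, hVle, c, fun j hj => ⟨hcI j hj, hc3 j hj⟩, ?_⟩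
  -- the multiplier and the sign invariants along the chain
  set ψ : ℝ → ℝ := fun θ => ∏ j ∈ range V, (c j - θ) with hψ
  have hψxx : ∀ j < V, ψ (x j) * ψ (x (j + 1)) < 0 := by
    intro j hj
    have e : ψ (x j) * ψ (x (j + 1)) = ∏ i ∈ range V, ((c i - x j) * (c i - x (j + 1))) := by
      rw [hψ]; exact (prod_mul_distrib).symm
    rw [e, ← mul_prod_erase (range V) _ (mem_range.2 hj)]
    refine mul_neg_of_neg_of_pos (mul_neg_of_pos_of_neg (sub_pos.2 (hc1 j hj)) (sub_neg.2 (hc2 j hj))) ?_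
    refine prod_pos fun i hi => ?_
    obtain ⟨hij, hiV⟩ := mem_erase.1 hi
    rw [mem_range] at hiV
    rcases lt_or_gt_of_ne hij with hlt | hgt
    · exact mul_pos_of_neg_of_neg (sub_neg.2 ((hc2 i hiV).trans_le (hx.le (by omega) (by omega))))
        (sub_neg.2 ((hc2 i hiV).trans_le (hx.le (by omega) (by omega))))
    · exact mul_pos (sub_pos.2 ((hx.le (by omega) (by omega)).trans_lt (hc1 i hiV)))
        (sub_pos.2 ((hx.le (by omega) (by omega)).trans_lt (hc1 i hiV)))
  have hEE : ∀ j ≤ V, 0 < (φ (x 0) * ψ (x 0)) * (φ (x j) * ψ (x j)) := by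
    intro j hj
    induction j with
    | zero =>
      have hψ0 : ψ (x 0) ≠ 0 := by
        rw [hψ]
        exact prod_ne_zero_iff.2 fun i hi =>
          sub_ne_zero.2 (ne_of_gt ((hx.le (Nat.zero_le i) (by rw [mem_range] at hi; omega)).trans_lt
            (hc1 i (mem_range.1 hi))))
      exact mul_self_pos.2 (mul_ne_zero hx0 hψ0)
    | succ j ih =>
      have h1 := ih (by omega)
      have h2 : 0 < (φ (x j) * ψ (x j)) * (φ (x (j + 1)) * ψ (x (j + 1))) := by
        have := mul_pos_of_neg_of_neg (hx.2.2 j (by omega)) (hψxx j (by omega))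
        linarith [show φ (x j) * φ (x (j + 1)) * (ψ (x j) * ψ (x (j + 1))) =
          (φ (x j) * ψ (x j)) * (φ (x (j + 1)) * ψ (x (j + 1))) by ring]
      have hEj : φ (x j) * ψ (x j) ≠ 0 := by
        intro h0; rw [h0, zero_mul] at h2; exact lt_irrefl _ h2
      nlinarith [mul_pos h1 h2, mul_self_pos.2 hEj]
  -- the claim: the sign of ψ φ on I is that of E 0
  have claim : ∀ θ ∈ I, 0 ≤ (φ (x 0) * ψ (x 0)) * (ψ θ * φ θ) := by
    intro θ hθ
    by_contra hcon
    push Not at hcon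
    have hφθ : φ θ ≠ 0 := by intro h0; rw [h0, mul_zero, mul_zero] at hcon; exact lt_irrefl _ hcon
    have hψθ : ψ θ ≠ 0 := by intro h0; rw [h0, zero_mul, mul_zero] at hcon; exact lt_irrefl _ hcon
    have hcne : ∀ j < V, c j ≠ θ := by
      intro j hj hce
      apply hψθ
      rw [hψ]
      exact prod_eq_zero (mem_range.2 hj) (by rw [hce, sub_self])
    -- position of θ among the c j
    have hex : ∃ k, V ≤ k ∨ θ < c k := ⟨V, Or.inl le_rfl⟩
    set k := Nat.find hex with hk
    have hk_spec : V ≤ k ∨ θ < c k := Nat.find_spec hex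
    have hkV : k ≤ V := Nat.find_min' hex (Or.inl le_rfl)
    have hbelow : ∀ j < k, c j < θ := by
      intro j hj
      have := Nat.find_min hex (hk ▸ hj)
      push Not at this
      exact lt_of_le_of_ne this.2 (hcne j (by omega))
    have habove : ∀ j, k ≤ j → j < V → θ < c j := by
      intro j hkj hjV
      rcases hk_spec with h1 | h2
      · omega
      · rcases eq_or_lt_of_le hkj with rfl | hlt
        · exact h2
        · calc θ < c k := h2
            _ < x (k + 1) := hc2 k (by omega)
            _ ≤ x j := hx.le (by omega) (by omega)
            _ < c j := hc1 j hjV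
    have hψψ : 0 < ψ θ * ψ (x k) := by
      have e : ψ θ * ψ (x k) = ∏ j ∈ range V, ((c j - θ) * (c j - x k)) := by
        rw [hψ]; exact (prod_mul_distrib).symm
      rw [e]
      refine prod_pos fun j hj => ?_
      rw [mem_range] at hj
      by_cases hjk : j < k
      · exact mul_pos_of_neg_of_neg (sub_neg.2 (hbelow j hjk))
          (sub_neg.2 ((hc2 j hj).trans_le (hx.le (by omega) hkV)))
      · push Not at hjk
        exact mul_pos (sub_pos.2 (habove j hjk hj)) (sub_pos.2 ((hx.le hjk (by omega)).trans_lt (hc1 j hj)))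
    -- hence φ (x k) φ θ < 0
    have hkθ : φ (x k) * φ θ < 0 := by
      have h1 := hEE k hkV
      have s1 : (φ (x k) * ψ (x k)) * (ψ θ * φ θ) < 0 := by
        nlinarith [mul_neg_of_pos_of_neg h1 hcon, mul_self_nonneg (φ (x 0) * ψ (x 0))]
      have e : (φ (x k) * ψ (x k)) * (ψ θ * φ θ) = (φ (x k) * φ θ) * (ψ θ * ψ (x k)) := by ring
      rw [e] at s1
      nlinarith [s1, hψψ]
    -- case analysis on the position of θ relative to x k
    rcases lt_trichotomy θ (x k) with hlt | heq | hgt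
    · rcases Nat.eq_zero_or_pos k with hk0 | hkpos
      · -- θ before the whole chain: prepend
        rw [hk0] at hlt hkθ
        refine hmax (V + 1) (by omega) ⟨_, isAltChain_prepend hx hθ hlt (by linarith [mul_comm (φ θ) (φ (x 0))]), ?_⟩
        simpa using hφθ
      · -- c (k-1) < θ < x k: insert a point w ∈ (c (k-1), θ) of the new sign, then θ
        have hk1 : k - 1 < V := by omega
        obtain ⟨w, hcw, hwθ, hwx, hsw⟩ := hc5 (k - 1) hk1 (θ - c (k - 1)) (sub_pos.2 (hbelow (k - 1) (by omega)))
        have hwθ' : w < θ := by linarith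
        have hkk : k - 1 + 1 = k := by omega
        rw [hkk] at hwx
        have hxw : x (k - 1) < w := (hc1 (k - 1) hk1).trans hcw
        have hwI : w ∈ I := hI.out (hx.1 (k - 1) (by omega)) (hx.1 k hkV) ⟨hxw.le, hwx⟩
        have hxx : φ (x (k - 1)) * φ (x k) < 0 := by
          have := hx.2.2 (k - 1) hk1; rwa [hkk] at this
        have hwk : 0 < φ w * φ (x k) := by
          nlinarith [mul_pos_of_neg_of_neg hsw hxx, mul_self_nonneg (φ (x (k - 1))),
            mul_self_pos.2 (hxne (k - 1) (by omega))]
        have hs2 : φ w * φ θ < 0 := by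
          nlinarith [mul_neg_of_pos_of_neg hwk hkθ, mul_self_pos.2 (hxne k hkV)]
        have hs3 : φ θ * φ (x k) < 0 := by linarith [mul_comm (φ θ) (φ (x k))]
        refine hmax (V + 2) (by omega) ⟨_, isAltChain_insert2 hx hkpos hkV hwI hθ hxw hwθ' hlt hsw hs2 hs3, ?_⟩
        simp only [if_pos hkpos]
        exact hx0
    · rw [heq] at hkθ
      exact absurd hkθ (not_lt.2 (mul_self_nonneg _))
    · by_cases hkV' : k = V
      · -- θ after the whole chain: append
        rw [hkV'] at hgt hkθ
        refine hmax (V + 1) (by omega) ⟨_, isAltChain_append hx hθ hgt hkθ, ?_⟩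
        simp only [Nat.zero_le, if_true]
        exact hx0
      · have hkV2 : k < V := lt_of_le_of_ne hkV hkV'
        rcases hk_spec with h1 | h2
        · omega
        · exact absurd hkθ (not_lt.2 (hc4 k hkV2 θ hgt.le h2.le))
  -- conclusion
  have hE0 : φ (x 0) * ψ (x 0) ≠ 0 := by
    have := hEE 0 (Nat.zero_le _)
    intro h0; rw [h0, zero_mul] at this; exact lt_irrefl _ this
  rcases lt_or_gt_of_ne hE0 with hneg | hpos
  · exact Or.inr fun θ hθ => by have := claim θ hθ; nlinarith
  · exact Or.inl fun θ hθ => by have := claim θ hθ; nlinarith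

end ToyALaw

end Summit.ValiantsHypothesis.ValiantsHypothesis.Theorems.LacunarySymmetroidMatrixDescartes
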